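import Summits.PneNP.PneNP.Theorems.KarlinRubinMonotoneSufficesGreedyParamsN
import Summits.PneNP.PneNP.Theorems.KarlinRubinMonotoneSufficesRoomParams

/-!
# Crux `MonotoneSuffices` (stmt-PneNP-18026), the GREEDY general detector — part 10c: parameters (real side)

From the integer facts of part 10b (`natFacts6`; notation `k, L, Q, t, M, θ`, `μ = n 2^{-t} ∈ [k²/(4(L+1)⁶), k²/(L+1)⁶)`)
this file derives the real inequalities consumed by the five ingredients (H0)–(H4) of the averaging (part 8):

* `nullSide6` — with `η = ⌊k/4⌋/μ`: `0 ≤ η ≤ 2`, `(1+η) μ ≤ θ`, tail `exp(-η² μ'/4) ≤ exp(-(L+1)⁶/512)`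
  (`μ' = (n - tM) 2^{-t} ≥ μ/2`);
* `plantedSide6` — with `η₁ = k/(8 μ₂)`, `μ₂ = (n - tM - k) 2^{-t}`: `0 ≤ η₁ ≤ 1`, `θ - ⌊k/2⌋ ≤ (1-η₁) μ₂`,
  tail `≤ exp(-(L+1)⁶/512)`;
* `badNoise6` — `2^k exp(-(n-k) 2^{-(t-1)}/4) ≤ exp(-(L+1))`;
(the threading probability, the hypergeometric term and the number of trials are part 10d). Elementary real
arithmetic.
-/

set_option linter.dupNamespace false -- `Summit.PneNP.PneNP.…`: summit = sub-problem name (D-0017 single-conjunct layout)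

namespace Summit.PneNP.PneNP.Theorems.MonotoneSuffices.Greedy

open Real Finset
open Summit.PneNP.PneNP.Theorems.MonotoneSuffices.Room

/-! ### The scale `μ = n 2^{-t}` -/

/-- **Bounds on `μ = n 2^{-t}`**: `k²/(4(L+1)⁶) ≤ μ < k²/(L+1)⁶`, hence `160 k ≤ μ`. [folklore] -/
theorem mu_bounds6 {n k L Q t : ℕ} (hQt : Q < 2 ^ t) (ht2Q : 2 ^ t ≤ 2 * Q)
    (hQk : Q * k ^ 2 ≤ n * (L + 1) ^ 6 + k ^ 2) (hQk' : n * (L + 1) ^ 6 < Q * k ^ 2) (hk2 : k ^ 2 ≤ 4 * n)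
    (hkBig : 640 * (L + 1) ^ 6 ≤ k) (hL11 : 11 ≤ L) :
    (k : ℝ) ^ 2 / (4 * ((L : ℝ) + 1) ^ 6) ≤ (n : ℝ) * (2 : ℝ)⁻¹ ^ t ∧
      (n : ℝ) * (2 : ℝ)⁻¹ ^ t < (k : ℝ) ^ 2 / ((L : ℝ) + 1) ^ 6 ∧ 160 * (k : ℝ) ≤ (n : ℝ) * (2 : ℝ)⁻¹ ^ t := by
  have h2t : (0 : ℝ) < 2 ^ t := by positivity
  have hL6 : (0 : ℝ) < ((L : ℝ) + 1) ^ 6 := by positivity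
  have hμ : (n : ℝ) * (2 : ℝ)⁻¹ ^ t = n / 2 ^ t := by rw [inv_pow, div_eq_mul_inv]
  rw [hμ]
  -- upper: `n (L+1)^6 < 2^t k²`
  have hup : (n : ℝ) / 2 ^ t < (k : ℝ) ^ 2 / ((L : ℝ) + 1) ^ 6 := by
    rw [div_lt_div_iff₀ h2t hL6]
    have h : ((n * (L + 1) ^ 6 : ℕ) : ℝ) < ((2 ^ t * k ^ 2 : ℕ) : ℝ) := by
      exact_mod_cast hQk'.trans_le (Nat.mul_le_mul_right _ hQt.le)
    push_cast at h
    linarith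
  -- lower: `2^t k² ≤ 2 Q k² ≤ 2 (n (L+1)^6 + k²) ≤ 4 n (L+1)^6`
  have hlow : (k : ℝ) ^ 2 / (4 * ((L : ℝ) + 1) ^ 6) ≤ (n : ℝ) / 2 ^ t := by
    rw [div_le_div_iff₀ (by positivity) h2t]
    have hL1 : 1 ≤ (L + 1) ^ 6 := Nat.one_le_pow _ _ (by omega)
    have h : 2 ^ t * k ^ 2 ≤ 4 * n * (L + 1) ^ 6 := by
      calc 2 ^ t * k ^ 2 ≤ 2 * Q * k ^ 2 := Nat.mul_le_mul_right _ ht2Q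
        _ = 2 * (Q * k ^ 2) := by ring
        _ ≤ 2 * (n * (L + 1) ^ 6 + k ^ 2) := Nat.mul_le_mul_left _ hQk
        _ ≤ 2 * (n * (L + 1) ^ 6 + 4 * n) := by omega
        _ ≤ 2 * (n * (L + 1) ^ 6 + n * (L + 1) ^ 6) := by
            have : 4 * n ≤ n * (L + 1) ^ 6 := by
              have : 4 ≤ (L + 1) ^ 6 := le_trans (by norm_num) (Nat.pow_le_pow_left (show 2 ≤ L + 1 by omega) 6)
              nlinarith
            omega
        _ = 4 * n * (L + 1) ^ 6 := by ring
    have h' : ((2 ^ t * k ^ 2 : ℕ) : ℝ) ≤ ((4 * n * (L + 1) ^ 6 : ℕ) : ℝ) := by exact_mod_cast h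
    push_cast at h'
    linarith
  refine ⟨hlow, hup, le_trans ?_ hlow⟩
  -- `160 k ≤ k²/(4 (L+1)^6)` from `640 (L+1)^6 ≤ k`
  rw [le_div_iff₀ (by positivity)]
  have hkB : (640 : ℝ) * ((L : ℝ) + 1) ^ 6 ≤ k := by exact_mod_cast hkBig
  have hk0 : (0 : ℝ) ≤ k := Nat.cast_nonneg k
  nlinarith

/-! ### Null side -/

/-- **Null side.** With `q = ⌊k/4⌋`, `μ = n 2^{-t}`, `μ' = (n - tM) 2^{-t}`: `0 ≤ q/μ ≤ 2`, `(1 + q/μ) μ ≤ θ` and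
`exp(-(q/μ)² μ'/4) ≤ exp(-(L+1)⁶/512)`. [folklore] -/
theorem nullSide6 {n k L t M θ : ℕ} (hθ : θ = n / 2 ^ t + k / 4 + 1)
    (hμlo : 160 * (k : ℝ) ≤ (n : ℝ) * (2 : ℝ)⁻¹ ^ t) (hμhi : (n : ℝ) * (2 : ℝ)⁻¹ ^ t < (k : ℝ) ^ 2 / ((L : ℝ) + 1) ^ 6)
    (htM : 2 * (t * M) + 2 * k ≤ n) (hk8 : 8 ≤ k) :
    0 ≤ ((k / 4 : ℕ) : ℝ) / ((n : ℝ) * (2 : ℝ)⁻¹ ^ t) ∧ ((k / 4 : ℕ) : ℝ) / ((n : ℝ) * (2 : ℝ)⁻¹ ^ t) ≤ 2 ∧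
      (1 + ((k / 4 : ℕ) : ℝ) / ((n : ℝ) * (2 : ℝ)⁻¹ ^ t)) * ((n : ℝ) * (2 : ℝ)⁻¹ ^ t) ≤ θ ∧
      Real.exp (-((((k / 4 : ℕ) : ℝ) / ((n : ℝ) * (2 : ℝ)⁻¹ ^ t)) ^ 2 * (((n - t * M : ℕ) : ℝ) * (2 : ℝ)⁻¹ ^ t) / 4)) ≤
        Real.exp (-(((L : ℝ) + 1) ^ 6 / 512)) := by
  set μ : ℝ := (n : ℝ) * (2 : ℝ)⁻¹ ^ t with hμ
  set q : ℝ := ((k / 4 : ℕ) : ℝ) with hq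
  have hk0 : (0 : ℝ) < k := by exact_mod_cast (show 0 < k by omega)
  have hμpos : 0 < μ := lt_of_lt_of_le (by positivity) hμlo
  have hqb := natDiv_bounds k 4 (by norm_num)
  have hq4 : q ≤ (k : ℝ) / 4 := by rw [hq]; exact_mod_cast hqb.2
  have hq4' : (k : ℝ) / 4 - 1 < q := by rw [hq]; exact_mod_cast hqb.1
  have hq0 : 0 ≤ q := Nat.cast_nonneg _
  have hq8 : (k : ℝ) / 8 ≤ q := by
    have hk8' : (8 : ℝ) ≤ k := by exact_mod_cast hk8
    linarith
  refine ⟨div_nonneg hq0 hμpos.le, ?_, ?_, ?_⟩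
  · rw [div_le_iff₀ hμpos]; nlinarith
  · rw [add_mul, one_mul, div_mul_cancel₀ _ hμpos.ne']
    -- `θ = ⌊n/2^t⌋ + ⌊k/4⌋ + 1 ≥ μ - 1 + q + 1`
    have hnb := natDiv_bounds n (2 ^ t) (by positivity)
    have hcast : (θ : ℝ) = ((n / 2 ^ t : ℕ) : ℝ) + q + 1 := by rw [hθ, hq]; push_cast; ring
    have hμ' : μ = (n : ℝ) / ((2 ^ t : ℕ) : ℝ) := by rw [hμ, inv_pow, div_eq_mul_inv]; push_cast; ring
    rw [hcast]
    rw [← hμ'] at hnb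
    linarith [hnb.1]
  · refine Real.exp_le_exp.2 (neg_le_neg ?_)
    -- `μ' ≥ μ/2`
    have hμ' : μ / 2 ≤ ((n - t * M : ℕ) : ℝ) * (2 : ℝ)⁻¹ ^ t := by
      have htn : t * M ≤ n := by omega
      rw [Nat.cast_sub htn, hμ]
      have h2 : (0 : ℝ) ≤ (2 : ℝ)⁻¹ ^ t := by positivity
      have hh : (n : ℝ) / 2 ≤ (n : ℝ) - (t * M : ℕ) := by
        have : ((2 * (t * M) : ℕ) : ℝ) ≤ n := by exact_mod_cast (show 2 * (t * M) ≤ n by omega)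
        push_cast at this ⊢; linarith
      calc (n : ℝ) * (2 : ℝ)⁻¹ ^ t / 2 = (n : ℝ) / 2 * (2 : ℝ)⁻¹ ^ t := by ring
        _ ≤ ((n : ℝ) - (t * M : ℕ)) * (2 : ℝ)⁻¹ ^ t := mul_le_mul_of_nonneg_right hh h2
    -- `(q/μ)² μ' / 4 ≥ q²/(8μ) ≥ k²/(512 μ) ≥ (L+1)^6/512`
    have hL6 : (0 : ℝ) < ((L : ℝ) + 1) ^ 6 := by positivity
    have hkμ : ((L : ℝ) + 1) ^ 6 * μ ≤ (k : ℝ) ^ 2 := by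
      have := hμhi.le; rwa [le_div_iff₀ hL6, mul_comm] at this
    have h1 : (q / μ) ^ 2 * (μ / 2) / 4 ≤ (q / μ) ^ 2 * (((n - t * M : ℕ) : ℝ) * (2 : ℝ)⁻¹ ^ t) / 4 := by
      have : 0 ≤ (q / μ) ^ 2 := sq_nonneg _
      nlinarith [mul_le_mul_of_nonneg_left hμ' this]
    refine le_trans ?_ h1
    rw [div_pow, le_div_iff₀ (by norm_num : (0:ℝ) < 4)]
    have hμ2 : 0 < μ ^ 2 := by positivity
    have e : q ^ 2 / μ ^ 2 * (μ / 2) = q ^ 2 / (2 * μ) := by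
      field_simp
    rw [e]
    rw [le_div_iff₀ (by positivity)]
    nlinarith [pow_le_pow_left₀ (by positivity) hq8 2]

/-! ### Planted side -/

/-- **Planted side.** With `μ₂ = (n - tM - k) 2^{-t}`, `η₁ = k/(8 μ₂)`: `0 ≤ η₁ ≤ 1`, `tM + k ≤ n`,
`θ - ⌊k/2⌋ ≤ (1-η₁) μ₂`, and `exp(-η₁² μ₂/4) ≤ exp(-(L+1)⁶/512)`. [folklore] -/
theorem plantedSide6 {n k L t M θ : ℕ} (hθ : θ = n / 2 ^ t + k / 4 + 1)
    (hμlo : 160 * (k : ℝ) ≤ (n : ℝ) * (2 : ℝ)⁻¹ ^ t) (hμhi : (n : ℝ) * (2 : ℝ)⁻¹ ^ t < (k : ℝ) ^ 2 / ((L : ℝ) + 1) ^ 6)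
    (htM : 2 * (t * M) + 2 * k ≤ n) (hk32 : 32 ≤ k) (h16 : 16 * (t * M + k) * k ≤ n * (L + 1) ^ 6)
    (hQk' : n * (L + 1) ^ 6 < 2 ^ t * k ^ 2) :
    0 ≤ (k : ℝ) / (8 * (((n - t * M - k : ℕ) : ℝ) * (2 : ℝ)⁻¹ ^ t)) ∧
      (k : ℝ) / (8 * (((n - t * M - k : ℕ) : ℝ) * (2 : ℝ)⁻¹ ^ t)) ≤ 1 ∧ t * M + k ≤ n ∧
      (θ : ℝ) - ((k / 2 : ℕ) : ℝ) ≤ (1 - (k : ℝ) / (8 * (((n - t * M - k : ℕ) : ℝ) * (2 : ℝ)⁻¹ ^ t))) *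
        (((n - t * M - k : ℕ) : ℝ) * (2 : ℝ)⁻¹ ^ t) ∧
      Real.exp (-(((k : ℝ) / (8 * (((n - t * M - k : ℕ) : ℝ) * (2 : ℝ)⁻¹ ^ t))) ^ 2 *
        (((n - t * M - k : ℕ) : ℝ) * (2 : ℝ)⁻¹ ^ t) / 4)) ≤ Real.exp (-(((L : ℝ) + 1) ^ 6 / 512)) := by
  set μ : ℝ := (n : ℝ) * (2 : ℝ)⁻¹ ^ t with hμ
  set μ₂ : ℝ := ((n - t * M - k : ℕ) : ℝ) * (2 : ℝ)⁻¹ ^ t with hμ₂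
  have htn : t * M + k ≤ n := by omega
  have hk0 : (0 : ℝ) < k := by exact_mod_cast (show 0 < k by omega)
  have h2 : (0 : ℝ) < (2 : ℝ)⁻¹ ^ t := by positivity
  have h2t : (0 : ℝ) < 2 ^ t := by positivity
  -- `μ₂ ≥ μ/2` and `μ₂ ≤ μ` and `μ - μ₂ ≤ k/16`
  have hμ₂eq : μ₂ = ((n : ℝ) - (t * M : ℕ) - k) * (2 : ℝ)⁻¹ ^ t := by
    rw [hμ₂, Nat.sub_sub, Nat.cast_sub htn]; push_cast; ring
  have hhalf : μ / 2 ≤ μ₂ := by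
    rw [hμ₂eq, hμ]
    have hh : (n : ℝ) / 2 ≤ (n : ℝ) - (t * M : ℕ) - k := by
      have : ((2 * (t * M) + 2 * k : ℕ) : ℝ) ≤ n := by exact_mod_cast htM
      push_cast at this ⊢; linarith
    calc (n : ℝ) * (2 : ℝ)⁻¹ ^ t / 2 = (n : ℝ) / 2 * (2 : ℝ)⁻¹ ^ t := by ring
      _ ≤ _ := mul_le_mul_of_nonneg_right hh h2.le
  have hle : μ₂ ≤ μ := by
    rw [hμ₂eq, hμ]
    refine mul_le_mul_of_nonneg_right ?_ h2.le
    have : (0 : ℝ) ≤ (t * M : ℕ) := Nat.cast_nonneg _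
    linarith
  have hdiff : μ - μ₂ ≤ (k : ℝ) / 16 := by
    -- `16 (tM + k) < 2^t k`
    have hnat : 16 * (t * M + k) * k < 2 ^ t * k ^ 2 := lt_of_le_of_lt h16 hQk'
    have hnat' : 16 * (t * M + k) < 2 ^ t * k := by
      have e : 2 ^ t * k * k = 2 ^ t * k ^ 2 := by ring
      have : 16 * (t * M + k) * k < 2 ^ t * k * k := by rw [e]; exact hnat
      exact Nat.lt_of_mul_lt_mul_right this
    have hr : (16 * ((t * M : ℕ) + (k : ℝ))) ≤ 2 ^ t * k := by
      have : ((16 * (t * M + k) : ℕ) : ℝ) ≤ ((2 ^ t * k : ℕ) : ℝ) := by exact_mod_cast hnat'.le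
      push_cast at this ⊢; linarith
    rw [hμ, hμ₂eq]
    have hinv : (2 : ℝ)⁻¹ ^ t = 1 / 2 ^ t := by rw [inv_pow, one_div]
    rw [hinv]
    rw [show (n : ℝ) * (1 / 2 ^ t) - ((n : ℝ) - (t * M : ℕ) - k) * (1 / 2 ^ t) = ((t * M : ℕ) + (k : ℝ)) / 2 ^ t by ring]
    rw [div_le_div_iff₀ h2t (by norm_num)]
    linarith
  have hμ₂pos : 0 < μ₂ := lt_of_lt_of_le (by nlinarith) hhalf
  have hk8μ₂ : (k : ℝ) ≤ 8 * μ₂ := by nlinarith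
  refine ⟨by positivity, ?_, htn, ?_, ?_⟩
  · rw [div_le_one (by positivity)]; exact hk8μ₂
  · -- `θ - ⌊k/2⌋ ≤ μ - k/4 + 2 ≤ μ₂ - k/8 = (1-η₁) μ₂`
    have hnb := natDiv_bounds n (2 ^ t) (by positivity)
    have hqb := natDiv_bounds k 4 (by norm_num)
    have hhb := natDiv_bounds k 2 (by norm_num)
    have hcast : (θ : ℝ) = ((n / 2 ^ t : ℕ) : ℝ) + ((k / 4 : ℕ) : ℝ) + 1 := by rw [hθ]; push_cast; ring
    have hμ' : μ = (n : ℝ) / ((2 ^ t : ℕ) : ℝ) := by rw [hμ, inv_pow, div_eq_mul_inv]; push_cast; ring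
    rw [← hμ'] at hnb
    have h4 : ((4 : ℕ) : ℝ) = 4 := by norm_num
    have h2' : ((2 : ℕ) : ℝ) = 2 := by norm_num
    rw [h4] at hqb; rw [h2'] at hhb
    rw [hcast, sub_mul, one_mul, div_mul_eq_mul_div, mul_comm (k : ℝ) μ₂, ← div_mul_eq_mul_div]
    rw [show μ₂ / (8 * μ₂) * (k : ℝ) = k / 8 by field_simp]
    have hk32' : (32 : ℝ) ≤ k := by exact_mod_cast hk32
    linarith [hnb.2, hqb.2, hhb.1]
  · refine Real.exp_le_exp.2 (neg_le_neg ?_)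
    have hL6 : (0 : ℝ) < ((L : ℝ) + 1) ^ 6 := by positivity
    have hkμ : ((L : ℝ) + 1) ^ 6 * μ ≤ (k : ℝ) ^ 2 := by
      have := hμhi.le; rwa [le_div_iff₀ hL6, mul_comm] at this
    -- `η₁² μ₂ / 4 = k²/(256 μ₂) ≥ k²/(256 μ) ≥ (L+1)^6/256`
    rw [div_pow, show (k : ℝ) ^ 2 / (8 * μ₂) ^ 2 * μ₂ / 4 = (k : ℝ) ^ 2 / (256 * μ₂) by field_simp; ring]
    rw [div_le_div_iff₀ (by norm_num) (by positivity)]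
    nlinarith [mul_le_mul_of_nonneg_left hle hL6.le]

/-! ### Bad noise -/

/-- **Bad noise is negligible**: `2^k exp(-(n-k) 2^{-(t-1)}/4) ≤ exp(-(L+1))`. [folklore] -/
theorem badNoise6 {n k L t : ℕ} (hμlo : 160 * (k : ℝ) ≤ (n : ℝ) * (2 : ℝ)⁻¹ ^ t) (h2k : 2 * k ≤ n)
    (ht : 1 ≤ t) (hkL : L + 1 ≤ k) :
    (2 : ℝ) ^ k * Real.exp (-((((n - k : ℕ) : ℝ) * (2 : ℝ)⁻¹ ^ (t - 1)) / 4)) ≤ Real.exp (-((L : ℝ) + 1)) := by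
  have h2 : (0 : ℝ) < (2 : ℝ)⁻¹ ^ t := by positivity
  -- `(n-k) 2^{-(t-1)} = 2 (n-k) 2^{-t} ≥ n 2^{-t} ≥ 160 k`
  have hpow : (2 : ℝ)⁻¹ ^ (t - 1) = 2 * (2 : ℝ)⁻¹ ^ t := by
    obtain ⟨t', rfl⟩ : ∃ t', t = t' + 1 := ⟨t - 1, by omega⟩
    simp [pow_succ]; ring
  have hnk : (n : ℝ) ≤ 2 * ((n - k : ℕ) : ℝ) := by
    rw [Nat.cast_sub (by omega)]
    have : ((2 * k : ℕ) : ℝ) ≤ n := by exact_mod_cast h2k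
    push_cast at this; linarith
  have hbig : 160 * (k : ℝ) ≤ ((n - k : ℕ) : ℝ) * (2 : ℝ)⁻¹ ^ (t - 1) := by
    rw [hpow]
    calc 160 * (k : ℝ) ≤ (n : ℝ) * (2 : ℝ)⁻¹ ^ t := hμlo
      _ ≤ (2 * ((n - k : ℕ) : ℝ)) * (2 : ℝ)⁻¹ ^ t := mul_le_mul_of_nonneg_right hnk h2.le
      _ = ((n - k : ℕ) : ℝ) * (2 * (2 : ℝ)⁻¹ ^ t) := by ring
  -- `2^k ≤ e^k`
  have h2e : (2 : ℝ) ^ k ≤ Real.exp k := by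
    calc (2 : ℝ) ^ k ≤ (Real.exp 1) ^ k :=
          pow_le_pow_left₀ (by norm_num) (by linarith [Real.add_one_le_exp (1 : ℝ)]) _
      _ = Real.exp k := by rw [← Real.exp_nat_mul, mul_one]
  have hkL' : (L : ℝ) + 1 ≤ k := by exact_mod_cast hkL
  calc (2 : ℝ) ^ k * Real.exp (-((((n - k : ℕ) : ℝ) * (2 : ℝ)⁻¹ ^ (t - 1)) / 4))
      ≤ Real.exp k * Real.exp (-((((n - k : ℕ) : ℝ) * (2 : ℝ)⁻¹ ^ (t - 1)) / 4)) :=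
        mul_le_mul_of_nonneg_right h2e (Real.exp_pos _).le
    _ = Real.exp (k + -((((n - k : ℕ) : ℝ) * (2 : ℝ)⁻¹ ^ (t - 1)) / 4)) := (Real.exp_add _ _).symm
    _ ≤ Real.exp (-((L : ℝ) + 1)) := Real.exp_le_exp.2 (by linarith)

end Summit.PneNP.PneNP.Theorems.MonotoneSuffices.Greedy

namespace Summit.PneNP.PneNP.Theorems.MonotoneSuffices.Greedy

/-- Registered sub-goal `greedy_paramsB` of stmt-PneNP-18026 (greedy detector, part 10c): bad noise is
negligible, exported verbatim. [folklore] -/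
theorem greedy_paramsB :
    ∀ {n k L t : ℕ}, 160 * (k : ℝ) ≤ (n : ℝ) * (2 : ℝ)⁻¹ ^ t → 2 * k ≤ n → 1 ≤ t → L + 1 ≤ k → (2 : ℝ) ^ k * Real.exp (-((((n - k : ℕ) : ℝ) * (2 : ℝ)⁻¹ ^ (t - 1)) / 4)) ≤ Real.exp (-((L : ℝ) + 1)) :=
  fun hμlo h2k ht hkL => badNoise6 hμlo h2k ht hkL

end Summit.PneNP.PneNP.Theorems.MonotoneSuffices.Greedy
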